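import Literature.Analysis.FluidPDE.PassiveScalarEnergySlice
import Literature.Analysis.FluidPDE.PassiveScalarEnergyMollified
import HarnessLib

/-!
# Energy inequality for the passive scalar, III: discharge of `energy_ineq` and
  `eScalarDissipation_le_variance`

Analysis/FluidPDE proof file for the named facts
`Literature.Analysis.FluidPDE.Torus.IsWeakScalarTransportOn.energy_ineq` and
`Literature.Analysis.FluidPDE.Torus.IsWeakScalarTransportOn.eScalarDissipation_le_variance` of `FluidPDE/PassiveScalar`:
for `κ > 0`, `θ₀ ∈ L²(T^d)`, `u ∈ L^∞((0,T) × T^d)` (space–time lift) and *every* weak solution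
`θ ∈ L^∞(0,T; L²)` of `∂ₜθ + u·∇θ = κΔθ` on `T^d × [0,T)`,
`2κ ∫₀ᵀ ‖∇θ(t)‖²_{L²} dt ≤ ‖θ₀‖²_{L²}` (`energy_ineq_holds`) and `≤ Var θ₀`
(`eScalarDissipation_le_variance_holds`), the gradient norm being the spectral
`Torus.eScalarGradNormSq` (Bonicatto–Ciampa–Crippa 2023, Thm. 3.3 with `p = ∞`, `q = 2`:
distributional solutions with `1/p + 1/q ≤ 1/2` are parabolic and satisfy the energy balance
(3.4); Drivas–Elgindi–Iyer–Jeong 2022, (1.2), the formal identity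
`½‖θ(t)‖² = ½‖θ₀‖² - κ∫₀ᵗ‖∇θ‖²`).

Proof (files I–II: `PassiveScalarEnergySlice`, `PassiveScalarEnergyMollified`). Mollify in
space with `k_ε = kernel ε`, `εₙ = 1/(4(n+1))`, `Aₙ(t) = θ(t) ⋆ kₙ`. For a.e. `t`,
`‖Aₙ(t)‖² = ‖θ₀ ⋆ kₙ‖² + 2∫₀ᵗ∫ Aₙ Gₙ` (file II) and, slice-wise for a.e. `s`,
`∫ Aₙ Gₙ + κ‖∇Aₙ‖² ≤ 2‖u‖_∞ Eₙ(s) ‖∇Aₙ(s)‖₂` with `Eₙ(s) = ‖θ(s) ⋆ kₙ - θ(s)‖₂` (file I); by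
Hölder in time `2κ Xₙ(t) ≤ ‖θ₀‖₂² + 4‖u‖_∞ (∫₀ᵀ Eₙ²)^{1/2} Xₙ(T)^{1/2}`,
`Xₙ(t) = ∫₀ᵗ‖∇Aₙ‖₂²`, first for a.e. `t` and then for `t = T`
(`Literature.Analysis.FluidPDE.setIntegral_Ioo_le_of_ae_setIntegral_Ioc_le`). Since `Eₙ(s) → 0` for a.e. `s`
(`TorusConvolution.tendsto_eLpNorm_convolution_sub_self`) with `Eₙ ≤ 2 sup‖θ(s)‖₂`, dominated
convergence gives `∫₀ᵀ Eₙ² → 0`, so `2κ Xₙ(T) ≤ ‖θ₀‖₂² + δ` eventually, for every `δ > 0`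
(`Literature.Analysis.FluidPDE.eventually_le_add_of_le_add_mul_sqrt`; this step contains the uniform `L²_t H¹_x` bound,
i.e. parabolicity). Finally `2κ ∫₀ᵀ ‖∇θ‖² ≤ liminfₙ 2κ Xₙ(T)` by the lower semicontinuity of the
spectral gradient norm under `Aₙ(s) → θ(s)` in `L²` and Fatou in time. The variance form follows
by applying this to `θ - ⨍θ₀`, a weak solution with datum `θ₀ - ⨍θ₀` (`sub_const`) and the same
gradient norm.

## Mathlib / tree search

Mathlib (this pin): `ENNReal.lintegral_mul_le_Lp_mul_Lq`, `lintegral_liminf_le'`,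
`tendsto_lintegral_of_dominated_convergence'`, `Integrable.tendsto_setIntegral_nhds_zero`,
`intervalIntegral.integral_eq_sub_of_hasDerivAt`, `ae_le_eLpNormEssSup`,
`Measure.ae_ae_of_ae_prod`; no advection–diffusion / parabolic energy estimates (searched
`energy` in `Analysis/PDE`, `advection`: none). Tree: files I–II, `PassiveScalarProofs`,
`FlatTorusProofs` (`quasiMeasurePreserving_repr`), `TorusSpaceTime`
(`IsSmoothSpaceTimeOn.hasDerivWithinAt_integral`, `continuousOn_integral`).

## References

* P. Bonicatto, G. Ciampa, G. Crippa, *Weak and parabolic solutions of advection–diffusion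
  equations with rough velocity field*, J. Evol. Equ. 24 (2024), Paper No. 1
  (arXiv:2306.15529), Def. 2.1, Thm. 3.3, (3.1)–(3.4), Remark 3.4. Bib key
  `BonicattoCiampaCrippa2023`.
* T. D. Drivas, T. M. Elgindi, G. Iyer, I.-J. Jeong, *Anomalous dissipation in passive scalar
  transport*, Arch. Ration. Mech. Anal. 243 (2022), 1151–1180 (arXiv:1911.03271), (1.1)–(1.2).
  Bib key `DEIJ2022`.
* J. C. Robinson, J. L. Rodrigo, W. Sadowski, *The three-dimensional Navier–Stokes equations*
  (CUP 2016), Lemma 4.5, (4.19) (lower semicontinuity of norms, Fourier side). Bib key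
  `RobinsonRodrigoSadowski2016`.
-/

noncomputable section

open MeasureTheory TopologicalSpace Set Function Filter Topology Metric ContinuousLinearMap
  UnitAddTorus
open scoped ENNReal NNReal Convolution ContDiff InnerProductSpace

namespace Literature.Analysis.FluidPDE

/-! ## Two elementary lemmas -/

/-- **From a.e. times to the full interval.** If `g` is integrable on `(0,T)` and
`∫_{(0,t]} g ≤ K` for a.e. `t ∈ (0,T)`, then `∫_{(0,T)} g ≤ K` (there are good times
`tₙ → T⁻`, and `∫_{(tₙ,T)} g → 0` by absolute continuity of the integral). [folklore] -/
theorem setIntegral_Ioo_le_of_ae_setIntegral_Ioc_le {g : ℝ → ℝ} {T K : ℝ} (hT : 0 < T)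
    (hg : IntegrableOn g (Ioo 0 T) volume)
    (h : ∀ᵐ t ∂((volume : Measure ℝ).restrict (Ioo 0 T)), ∫ s in Ioc 0 t, g s ≤ K) :
    ∫ s in Ioo 0 T, g s ≤ K := by
  -- good times `tₙ ∈ (max 0 (T - 1/(n+1)), T)`
  have hgood : ∀ n : ℕ, ∃ t ∈ Ioo (max 0 (T - 1 / ((n : ℝ) + 1))) T, ∫ s in Ioc 0 t, g s ≤ K := by
    intro n
    set a : ℝ := max 0 (T - 1 / ((n : ℝ) + 1)) with ha
    have haT : a < T := max_lt hT (by
      have : (0 : ℝ) < 1 / ((n : ℝ) + 1) := by positivity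
      linarith)
    have hsub : Ioo a T ⊆ Ioo 0 T := Ioo_subset_Ioo_left (le_max_left _ _)
    have h' : ∀ᵐ t ∂((volume : Measure ℝ).restrict (Ioo a T)), t ∈ Ioo a T ∧ ∫ s in Ioc 0 t, g s ≤ K :=
      (ae_restrict_mem measurableSet_Ioo).and (ae_restrict_of_ae_restrict_of_subset hsub h)
    haveI hne : (ae ((volume : Measure ℝ).restrict (Ioo a T))).NeBot := by
      rw [ae_neBot, Ne, Measure.restrict_eq_zero, Real.volume_Ioo, ENNReal.ofReal_eq_zero, not_le]
      linarith
    obtain ⟨t, ht⟩ := h'.exists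
    exact ⟨t, ht.1, ht.2⟩
  choose t ht hK using hgood
  have ht0 : ∀ n, 0 < t n := fun n => (le_max_left _ _).trans_lt (ht n).1
  -- `tₙ → T`
  have htT : Tendsto t atTop (𝓝 T) := by
    have hlow : Tendsto (fun n : ℕ => T - 1 / ((n : ℝ) + 1)) atTop (𝓝 T) := by
      have := (tendsto_one_div_add_atTop_nhds_zero_nat (𝕜 := ℝ)).const_sub T
      simpa using this
    exact tendsto_of_tendsto_of_tendsto_of_le_of_le hlow tendsto_const_nhds
      (fun n => ((le_max_right _ _).trans_lt (ht n).1).le) (fun n => (ht n).2.le)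
  -- the tail integrals tend to `0`
  have htail : Tendsto (fun n => ∫ s in Ioo (t n) T, g s) atTop (𝓝 0) := by
    have hmeas : Tendsto (((volume : Measure ℝ).restrict (Ioo 0 T)) ∘ fun n => Ioo (t n) T) atTop (𝓝 0) := by
      have e : (((volume : Measure ℝ).restrict (Ioo 0 T)) ∘ fun n => Ioo (t n) T) =
          fun n => ENNReal.ofReal (T - t n) := by
        funext n
        simp only [Function.comp_apply]
        rw [Measure.restrict_apply measurableSet_Ioo,
          inter_eq_left.2 (Ioo_subset_Ioo_left (ht0 n).le), Real.volume_Ioo]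
      rw [e, ← ENNReal.ofReal_zero]
      refine ENNReal.tendsto_ofReal ?_
      simpa using (tendsto_const_nhds (x := T)).sub htT
    have h1 := hg.tendsto_setIntegral_nhds_zero hmeas
    refine h1.congr fun n => ?_
    rw [Measure.restrict_restrict measurableSet_Ioo, inter_eq_left.2 (Ioo_subset_Ioo_left (ht0 n).le)]
  -- split `(0,T) = (0,tₙ] ∪ (tₙ,T)`
  have hsplit : ∀ n, ∫ s in Ioo 0 T, g s = (∫ s in Ioc 0 (t n), g s) + ∫ s in Ioo (t n) T, g s := by
    intro n
    rw [← setIntegral_union ((Ioc_disjoint_Ioi le_rfl).mono_right Ioo_subset_Ioi_self) measurableSet_Ioo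
      (hg.mono_set (Ioc_subset_Ioo_right (ht n).2)) (hg.mono_set (Ioo_subset_Ioo_left (ht0 n).le)),
      Ioc_union_Ioo_eq_Ioo (ht0 n).le (ht n).2]
  have hlim : Tendsto (fun n => ∫ s in Ioc 0 (t n), g s) atTop (𝓝 (∫ s in Ioo 0 T, g s)) := by
    have e : ∀ n, ∫ s in Ioc 0 (t n), g s = (∫ s in Ioo 0 T, g s) - ∫ s in Ioo (t n) T, g s := fun n => by
      rw [hsplit n]
      ring
    simp_rw [e]
    simpa using (tendsto_const_nhds (x := ∫ s in Ioo 0 T, g s)).sub htail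
  exact le_of_tendsto' hlim hK

/-- **Absorbing a vanishing square-root term**: if `0 < κ`, `0 ≤ a`, `yₙ ≥ 0`,
`cₙ → 0` and `2κ yₙ ≤ a + cₙ √yₙ` for all `n`, then for every `δ > 0`, eventually
`2κ yₙ ≤ a + δ` (the `yₙ` are first bounded, `κ yₙ ≤ a + κ` once `cₙ ≤ κ`). [folklore] -/
theorem eventually_le_add_of_le_add_mul_sqrt {κ a : ℝ} (hκ : 0 < κ) (ha : 0 ≤ a) {y c : ℕ → ℝ}
    (hy : ∀ n, 0 ≤ y n) (hc0 : Tendsto c atTop (𝓝 0))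
    (h : ∀ n, 2 * κ * y n ≤ a + c n * Real.sqrt (y n)) {δ : ℝ} (hδ : 0 < δ) :
    ∀ᶠ n in atTop, 2 * κ * y n ≤ a + δ := by
  set R : ℝ := a / κ + 1 with hR_def
  have hR : 0 < R := by positivity
  have hsR : 0 < Real.sqrt R := Real.sqrt_pos.2 hR
  have hev : ∀ᶠ n in atTop, c n ≤ min κ (δ / Real.sqrt R) :=
    hc0.eventually (eventually_le_nhds (lt_min hκ (by positivity)))
  filter_upwards [hev] with n hn
  have hcκ : c n ≤ κ := hn.trans (min_le_left _ _)
  have hs0 : 0 ≤ Real.sqrt (y n) := Real.sqrt_nonneg _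
  have hsq : Real.sqrt (y n) ≤ 1 + y n := by
    nlinarith [Real.sq_sqrt (hy n), Real.sqrt_nonneg (y n)]
  -- uniform bound `y n ≤ R`
  have hyR : y n ≤ R := by
    have h2 : c n * Real.sqrt (y n) ≤ κ * (1 + y n) := mul_le_mul hcκ hsq hs0 hκ.le
    have h3 : κ * y n ≤ a + κ := by linarith [h n]
    have h4 : y n * κ ≤ R * κ := by
      rw [hR_def, add_mul, div_mul_cancel₀ _ hκ.ne']
      linarith
    exact le_of_mul_le_mul_right h4 hκ
  have hsqR : Real.sqrt (y n) ≤ Real.sqrt R := Real.sqrt_le_sqrt hyR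
  have hcδ : c n ≤ δ / Real.sqrt R := hn.trans (min_le_right _ _)
  calc 2 * κ * y n ≤ a + c n * Real.sqrt (y n) := h n
    _ ≤ a + (δ / Real.sqrt R) * Real.sqrt R := by
        gcongr a + ?_
        exact mul_le_mul hcδ hsqR hs0 (by positivity)
    _ = a + δ := by rw [div_mul_cancel₀ _ hsR.ne']

namespace Torus

variable {d : Type*} [Fintype d]

/-! ## The velocity bound and measurability of the mollified quantities -/

/-- **From `u ∈ L^∞((0,T) × ℝ^d)` (space–time lift) to an a.e. bound on the slices**: there is
`C ≥ 0` with `‖u(t, x)‖ ≤ C` for a.e. `x ∈ T^d`, for a.e. `t ∈ (0,T)` (the essential supremum,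
transported along the quasi-measure-preserving `id × repr` and Fubini). [folklore] -/
theorem ae_ae_norm_le_of_memLp_top_stLift {u : ℝ → UnitAddTorus d → EuclideanSpace ℝ d} {T : ℝ}
    (hu : MemLp (FunctionSpaces.Torus.stLift u) ∞ (volume.restrict (Ioo 0 T ×ˢ univ))) :
    ∃ C : ℝ, 0 ≤ C ∧ ∀ᵐ t ∂((volume : Measure ℝ).restrict (Ioo 0 T)), ∀ᵐ x ∂volume, ‖u t x‖ ≤ C := by
  set μ' : Measure (ℝ × EuclideanSpace ℝ d) := volume.restrict (Ioo 0 T ×ˢ univ) with hμ'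
  set C : ℝ := (eLpNorm (FunctionSpaces.Torus.stLift u) ∞ μ').toReal with hC
  have hfin : eLpNorm (FunctionSpaces.Torus.stLift u) ∞ μ' < (⊤ : ℝ≥0∞) := hu.eLpNorm_lt_top
  have hae' : ∀ᵐ p ∂μ', ‖FunctionSpaces.Torus.stLift u p‖ ≤ C := by
    filter_upwards [ae_le_eLpNormEssSup (f := FunctionSpaces.Torus.stLift u) (μ := μ')] with p hp
    rw [← eLpNorm_exponent_top] at hp
    have := ENNReal.toReal_mono hfin.ne hp
    rwa [toReal_enorm] at this
  refine ⟨C, ENNReal.toReal_nonneg, ?_⟩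
  have hprod : μ' = ((volume : Measure ℝ).restrict (Ioo 0 T)).prod volume := by
    rw [hμ', Measure.volume_eq_prod, ← Measure.prod_restrict, Measure.restrict_univ]
  rw [hprod] at hae'
  have hq := MeasureTheory.QuasiMeasurePreserving.prodMap
    (Measure.QuasiMeasurePreserving.id ((volume : Measure ℝ).restrict (Ioo 0 T)))
    (FunctionSpaces.Torus.quasiMeasurePreserving_repr (d := d))
  have h2 := hq.ae hae'
  have h3 : ∀ᵐ q : ℝ × UnitAddTorus d ∂(((volume : Measure ℝ).restrict (Ioo 0 T)).prod volume),
      ‖u q.1 q.2‖ ≤ C := by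
    filter_upwards [h2] with q hq'
    simpa [FunctionSpaces.Torus.stLift] using hq'
  exact Measure.ae_ae_of_ae_prod h3

namespace IsWeakScalarTransportOn

variable {T κ : ℝ} {u : ℝ → UnitAddTorus d → EuclideanSpace ℝ d} {θ₀ : UnitAddTorus d → ℝ}
  {θ : ℝ → UnitAddTorus d → ℝ}

/-- `s ↦ ‖θ(s) ⋆ k - θ(s)‖_{L²}` is a.e.-measurable on `(0,T)`. [folklore] -/
theorem aemeasurable_eLpNorm_conv_sub (h : IsWeakScalarTransportOn T κ u θ₀ θ)
    {k : UnitAddTorus d → ℝ} (hk : Continuous k) :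
    AEMeasurable (fun s => eLpNorm (θ s ⋆ k - θ s) 2 volume)
      ((volume : Measure ℝ).restrict (Ioo 0 T)) := by
  have hm : AEStronglyMeasurable (uncurry fun s x => (θ s ⋆ k) x - θ s x)
      (((volume : Measure ℝ).restrict (Ioo 0 T)).prod volume) :=
    (FunctionSpaces.Torus.aestronglyMeasurable_uncurry_convolution (lsmul ℝ ℝ) h.aestronglyMeasurable_uncurry hk).sub
      h.aestronglyMeasurable_uncurry
  exact aemeasurable_eLpNorm_two_of_uncurry hm

/-- `s ↦ ‖ ‖θ(s) ⋆ ∇k‖ ‖_{L²}` is a.e.-measurable on `(0,T)`. [folklore] -/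
theorem aemeasurable_eLpNorm_norm_conv_gradient (h : IsWeakScalarTransportOn T κ u θ₀ θ)
    {k : UnitAddTorus d → ℝ} (hk : FunctionSpaces.Torus.IsSmooth k) :
    AEMeasurable (fun s => eLpNorm (fun x => ‖(θ s ⋆ FunctionSpaces.Torus.gradient k) x‖) 2 volume)
      ((volume : Measure ℝ).restrict (Ioo 0 T)) := by
  have hm : AEStronglyMeasurable (uncurry fun s x => ‖(θ s ⋆ FunctionSpaces.Torus.gradient k) x‖)
      (((volume : Measure ℝ).restrict (Ioo 0 T)).prod volume) :=
    (FunctionSpaces.Torus.aestronglyMeasurable_uncurry_convolution (lsmul ℝ ℝ) h.aestronglyMeasurable_uncurry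
      hk.gradient.continuous).norm
  exact aemeasurable_eLpNorm_two_of_uncurry hm

/-- `s ↦ ∫ ‖θ(s) ⋆ ∇k‖²` is a.e.-strongly measurable on `(0,T)`. [folklore] -/
theorem aestronglyMeasurable_integral_norm_sq_conv_gradient (h : IsWeakScalarTransportOn T κ u θ₀ θ)
    {k : UnitAddTorus d → ℝ} (hk : FunctionSpaces.Torus.IsSmooth k) :
    AEStronglyMeasurable (fun s => ∫ x, ‖(θ s ⋆ FunctionSpaces.Torus.gradient k) x‖ ^ 2)
      ((volume : Measure ℝ).restrict (Ioo 0 T)) := by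
  have hm : AEStronglyMeasurable (uncurry fun s x => ‖(θ s ⋆ FunctionSpaces.Torus.gradient k) x‖ ^ 2)
      (((volume : Measure ℝ).restrict (Ioo 0 T)).prod volume) :=
    (continuous_pow 2).comp_aestronglyMeasurable
      (FunctionSpaces.Torus.aestronglyMeasurable_uncurry_convolution (lsmul ℝ ℝ) h.aestronglyMeasurable_uncurry
        hk.gradient.continuous).norm
  exact hm.integral_prod_right'

/-! ## Discharge of `energy_ineq` -/

/-- **Discharge of `Torus.IsWeakScalarTransportOn.energy_ineq`** — the energy inequality for
weak solutions of the passive scalar equation with bounded drift: for `κ > 0`, `θ₀ ∈ L²(T^d)`,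
`u ∈ L^∞((0,T) × T^d)` and every weak solution `θ ∈ L^∞(0,T; L²)` on `[0,T)`,
`2κ ∫₀ᵀ ‖∇θ(t)‖²_{L²} dt ≤ ‖θ₀‖²_{L²}` (Bonicatto–Ciampa–Crippa 2023, Thm. 3.3 with `p = ∞`,
`q = 2`: every distributional solution with `1/p + 1/q ≤ 1/2` is parabolic and satisfies the
energy balance (3.4); Drivas–Elgindi–Iyer–Jeong 2022, (1.2)). Proof: mollify in space,
`A_ε = θ ⋆ k_ε`; the a.e.-in-time energy identity `‖A_ε(t)‖² = ‖θ₀ ⋆ k_ε‖² + 2∫₀ᵗ∫ A_ε G_ε`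
(`PassiveScalarEnergyMollified`) and the slice inequality
`∫ A_ε G_ε + κ‖∇A_ε‖² ≤ 2‖u‖_∞ ‖θ ⋆ k_ε - θ‖₂ ‖∇A_ε‖₂` (`PassiveScalarEnergySlice`, weak
incompressibility in place of the commutator estimate of BCC Lemma 3.1) give
`2κ Xε ≤ ‖θ₀‖₂² + bε √Xε` with `Xε = ∫₀ᵀ‖∇A_ε‖₂²` and `bε → 0` (dominated convergence,
`θ(s) ⋆ k_ε → θ(s)` in `L²`), whence `limsup 2κ Xε ≤ ‖θ₀‖₂²`; and
`∫₀ᵀ ‖∇θ‖² ≤ liminf Xε` by lower semicontinuity of the spectral gradient norm (Fatou). [cite: BonicattoCiampaCrippa2023, Thm. 3.3] -/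
theorem energy_ineq_holds : IsWeakScalarTransportOn.energy_ineq (d := d) := by
  intro T κ hκ u θ₀ θ h hθ₀ hu
  -- trivial case `T ≤ 0`
  rcases le_or_gt T 0 with hT | hT
  · have h0 : eScalarDissipation κ θ 0 T = 0 := by
      rw [eScalarDissipation, Ioo_eq_empty_of_le hT, Measure.restrict_empty, lintegral_zero_measure,
        mul_zero]
    rw [h0, mul_zero]
    exact zero_le
  set μT : Measure ℝ := (volume : Measure ℝ).restrict (Ioo 0 T) with hμT
  haveI : IsFiniteMeasure μT := by rw [hμT]; infer_instance
  -- the velocity bound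
  obtain ⟨Cv, hCv0, hCv⟩ := ae_ae_norm_le_of_memLp_top_stLift hu
  -- radii and kernels
  obtain ⟨hε, hε', hε0⟩ := molRadius_spec
  set ε : ℕ → ℝ := fun n => 1 / (4 * ((n : ℝ) + 1)) with hε_def
  have hkS : ∀ n, FunctionSpaces.Torus.IsSmooth (FunctionSpaces.Torus.kernel (d := d) (ε n)) := fun n => FunctionSpaces.Torus.isSmooth_kernel (hε n) (hε' n)
  have hk1 : ∀ n, ∫⁻ y, ‖FunctionSpaces.Torus.kernel (d := d) (ε n) y‖ₑ = 1 := fun n => FunctionSpaces.Torus.lintegral_enorm_kernel (hε n) (hε' n)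
  -- `L²` and `L¹` bounds on the slices
  obtain ⟨C₁, hC₁⟩ := h.exists_eLpNorm_le
  have hθ₀i : Integrable θ₀ volume := hθ₀.integrable one_le_two
  have hgood : ∀ᵐ s ∂μT, Integrable (θ s) volume ∧ AEStronglyMeasurable (u s) volume ∧
      (∀ᵐ y ∂volume, ‖u s y‖ ≤ Cv) ∧ FunctionSpaces.Torus.IsWeaklyDivFree (u s) ∧ MemLp (θ s) 2 volume ∧
      eLpNorm (θ s) 2 volume ≤ C₁ := by
    filter_upwards [h.ae_slice_integrable₁, hCv, h.ae_isWeaklyDivFree, h.ae_memLp_two, hC₁]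
      with s h1 h2 h3 h4 h5
    exact ⟨h1.1, h1.2.1, h2, h3, h4, h5⟩
  -- the mollified quantities
  set E : ℕ → ℝ → ℝ≥0∞ := fun n s => eLpNorm (θ s ⋆ FunctionSpaces.Torus.kernel (ε n) - θ s) 2 volume with hE_def
  set N : ℕ → ℝ → ℝ≥0∞ := fun n s =>
    eLpNorm (fun x => ‖(θ s ⋆ FunctionSpaces.Torus.gradient (FunctionSpaces.Torus.kernel (ε n))) x‖) 2 volume with hN_def
  set g : ℕ → ℝ → ℝ := fun n s => ∫ x, ‖(θ s ⋆ FunctionSpaces.Torus.gradient (FunctionSpaces.Torus.kernel (ε n))) x‖ ^ 2 with hg_def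
  set Φ : ℕ → ℝ → ℝ := fun n s => ∫ x, (θ s ⋆ FunctionSpaces.Torus.kernel (ε n)) x * ∫ y, θ s y *
    (-⟪u s y, FunctionSpaces.Torus.gradient (FunctionSpaces.Torus.kernel (ε n)) (x - y)⟫_ℝ + κ * FunctionSpaces.Torus.laplacian (FunctionSpaces.Torus.kernel (ε n)) (x - y))
    with hΦ_def
  have hEm : ∀ n, AEMeasurable (E n) μT := fun n => h.aemeasurable_eLpNorm_conv_sub (hkS n).continuous
  have hNm : ∀ n, AEMeasurable (N n) μT := fun n => h.aemeasurable_eLpNorm_norm_conv_gradient (hkS n)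
  have hgm : ∀ n, AEStronglyMeasurable (g n) μT := fun n =>
    h.aestronglyMeasurable_integral_norm_sq_conv_gradient (hkS n)
  have hg0 : ∀ n s, 0 ≤ g n s := fun n s => integral_nonneg fun x => sq_nonneg _
  -- `E n s ≤ 2 C₁` a.e., `E n s → 0` a.e., hence `∫ E² → 0`
  have hEle : ∀ n, ∀ᵐ s ∂μT, E n s ≤ 2 * C₁ := by
    intro n
    filter_upwards [hgood] with s hs
    have hAm : AEStronglyMeasurable (θ s ⋆ FunctionSpaces.Torus.kernel (ε n)) volume :=
      (FunctionSpaces.Torus.continuous_convolution hs.1 (hkS n).continuous).aestronglyMeasurable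
    calc E n s ≤ eLpNorm (θ s ⋆ FunctionSpaces.Torus.kernel (ε n)) 2 volume + eLpNorm (θ s) 2 volume :=
          eLpNorm_sub_le hAm hs.2.2.2.2.1.1 one_le_two
      _ ≤ (∫⁻ y, ‖FunctionSpaces.Torus.kernel (ε n) y‖ₑ) * eLpNorm (θ s) 2 volume + eLpNorm (θ s) 2 volume := by
          gcongr
          exact FunctionSpaces.Torus.eLpNorm_convolution_le hs.1.aestronglyMeasurable (hkS n).continuous.aestronglyMeasurable
            one_le_two
      _ ≤ 2 * C₁ := by
          rw [hk1 n, one_mul, two_mul]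
          exact add_le_add hs.2.2.2.2.2 hs.2.2.2.2.2
  have hE0 : ∀ᵐ s ∂μT, Tendsto (fun n => E n s) atTop (𝓝 0) := by
    filter_upwards [hgood] with s hs
    exact FunctionSpaces.Torus.tendsto_eLpNorm_convolution_sub_self hs.2.2.2.2.1 (fun n y => FunctionSpaces.Torus.kernel_nonneg (hε n).le y)
      (fun n => FunctionSpaces.Torus.integral_kernel (hε n) (hε' n)) (fun n => FunctionSpaces.Torus.support_kernel_subset (hε n))
      (fun n => FunctionSpaces.Torus.continuous_kernel (hε n) (hε' n)) hε0
  have hE2 : Tendsto (fun n => ∫⁻ s, E n s ^ 2 ∂μT) atTop (𝓝 0) := by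
    have hb : ∫⁻ _ : ℝ, ((2 : ℝ≥0∞) * C₁) ^ 2 ∂μT ≠ ⊤ := by
      rw [lintegral_const]
      exact ENNReal.mul_ne_top (ENNReal.pow_ne_top (ENNReal.mul_ne_top ENNReal.ofNat_ne_top
        ENNReal.coe_ne_top)) (measure_ne_top _ _)
    have hlim : ∀ᵐ s ∂μT, Tendsto (fun n => E n s ^ 2) atTop (𝓝 ((fun _ => (0 : ℝ≥0∞)) s)) := by
      filter_upwards [hE0] with s hs
      have := ((ENNReal.continuous_pow 2).tendsto 0).comp hs
      rw [zero_pow two_ne_zero] at this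
      exact this
    have := tendsto_lintegral_of_dominated_convergence' (fun _ => ((2 : ℝ≥0∞) * C₁) ^ 2)
      (fun n => (hEm n).pow_const 2) (fun n => (hEle n).mono fun s hs => by
        dsimp only
        gcongr) hb hlim
    simpa using this
  -- `g n` is bounded a.e. and integrable on `(0,T)`; `N n s ^ 2 = ofReal (g n s)` a.e.
  have hN2 : ∀ n, ∀ᵐ s ∂μT, N n s ^ 2 = ENNReal.ofReal (g n s) := by
    intro n
    filter_upwards [hgood] with s hs
    have hc : Continuous fun x => ‖(θ s ⋆ FunctionSpaces.Torus.gradient (FunctionSpaces.Torus.kernel (ε n))) x‖ :=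
      (FunctionSpaces.Torus.continuous_convolution hs.1 (hkS n).gradient.continuous).norm
    simp only [hN_def, hg_def]
    rw [PassiveScalarProofs.eLpNorm_two_pow_two, lintegral_enorm_sq_eq_ofReal_integral_sq hc]
  have hgb : ∀ n, ∃ K : ℝ, ∀ᵐ s ∂μT, g n s ≤ K := by
    intro n
    obtain ⟨Ck, hCk⟩ := FunctionSpaces.Torus.exists_forall_norm_le_of_continuous (hkS n).gradient.continuous
    refine ⟨(Ck * C₁) ^ 2, ?_⟩
    filter_upwards [hgood] with s hs
    have hpt : ∀ x, ‖(θ s ⋆ FunctionSpaces.Torus.gradient (FunctionSpaces.Torus.kernel (ε n))) x‖ ≤ Ck * C₁ := fun x => by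
      refine (FunctionSpaces.Torus.norm_convolution_le hs.1 hCk x).trans (mul_le_mul_of_nonneg_left ?_
        ((norm_nonneg _).trans (hCk 0)))
      have e : ∫ y, ‖θ s y‖ = ∫ y, |θ s y| := integral_congr_ae (Eventually.of_forall fun y => by
        simp [Real.norm_eq_abs])
      rw [e]
      exact integral_abs_le_of_eLpNorm_le hs.2.2.2.2.1 hs.2.2.2.2.2
    have hc : Continuous fun x => ‖(θ s ⋆ FunctionSpaces.Torus.gradient (FunctionSpaces.Torus.kernel (ε n))) x‖ :=
      (FunctionSpaces.Torus.continuous_convolution hs.1 (hkS n).gradient.continuous).norm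
    calc g n s ≤ ∫ _ : UnitAddTorus d, (Ck * C₁) ^ 2 := by
          refine integral_mono (hc.pow 2).integrable_unitAddTorus (integrable_const _) fun x => ?_
          dsimp only
          exact pow_le_pow_left₀ (norm_nonneg _) (hpt x) 2
      _ = (Ck * C₁) ^ 2 := by simp
  have hgi : ∀ n, Integrable (g n) μT := by
    intro n
    obtain ⟨K, hK⟩ := hgb n
    refine Integrable.mono' (integrable_const (max K 0)) (hgm n) ?_
    filter_upwards [hK] with s hs
    rw [Real.norm_eq_abs, abs_of_nonneg (hg0 n s)]
    exact hs.trans (le_max_left _ _)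
  have hY : ∀ n, ∫⁻ s, N n s ^ 2 ∂μT = ENNReal.ofReal (∫ s, g n s ∂μT) := by
    intro n
    rw [lintegral_congr_ae (hN2 n), ← ofReal_integral_eq_lintegral_ofReal (hgi n)
      (Eventually.of_forall (hg0 n))]
  -- the datum term
  set a : ℝ≥0∞ := ∫⁻ x, ‖θ₀ x‖ₑ ^ 2 with ha_def
  have hat : a ≠ ⊤ := by
    rw [ha_def, ← PassiveScalarProofs.eLpNorm_two_pow_two]
    exact ENNReal.pow_ne_top hθ₀.eLpNorm_ne_top
  have ha0 : ∀ n, ENNReal.ofReal (∫ x, (θ₀ ⋆ FunctionSpaces.Torus.kernel (ε n)) x ^ 2) ≤ a := by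
    intro n
    have hc : Continuous (θ₀ ⋆ FunctionSpaces.Torus.kernel (ε n)) := FunctionSpaces.Torus.continuous_convolution hθ₀i (hkS n).continuous
    rw [← lintegral_enorm_sq_eq_ofReal_integral_sq hc, ← PassiveScalarProofs.eLpNorm_two_pow_two, ha_def, ← PassiveScalarProofs.eLpNorm_two_pow_two]
    gcongr
    calc eLpNorm (θ₀ ⋆ FunctionSpaces.Torus.kernel (ε n)) 2 volume ≤ (∫⁻ y, ‖FunctionSpaces.Torus.kernel (ε n) y‖ₑ) * eLpNorm θ₀ 2 volume :=
          FunctionSpaces.Torus.eLpNorm_convolution_le hθ₀.1 (hkS n).continuous.aestronglyMeasurable one_le_two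
      _ = eLpNorm θ₀ 2 volume := by rw [hk1 n, one_mul]
  -- the vanishing coefficient `b n = 4 ‖u‖_∞ (∫ E²)^{1/2}`
  set b : ℕ → ℝ≥0∞ := fun n => 4 * ENNReal.ofReal Cv * (∫⁻ s, E n s ^ 2 ∂μT) ^ (1 / 2 : ℝ) with hb_def
  have hbt : ∀ n, b n ≠ ⊤ := by
    intro n
    refine ENNReal.mul_ne_top (ENNReal.mul_ne_top (by norm_num) ENNReal.ofReal_ne_top)
      (ENNReal.rpow_ne_top_of_nonneg (by norm_num) ?_)
    have hle : ∫⁻ s, E n s ^ 2 ∂μT ≤ ∫⁻ _ : ℝ, ((2 : ℝ≥0∞) * C₁) ^ 2 ∂μT :=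
      lintegral_mono_ae ((hEle n).mono fun s hs => pow_le_pow_left' hs 2)
    refine ne_top_of_le_ne_top ?_ hle
    rw [lintegral_const]
    exact ENNReal.mul_ne_top (ENNReal.pow_ne_top (ENNReal.mul_ne_top ENNReal.ofNat_ne_top
      ENNReal.coe_ne_top)) (measure_ne_top _ _)
  have hb0 : Tendsto b atTop (𝓝 0) := by
    have h1 := (hE2.ennrpow_const (1 / 2 : ℝ))
    rw [ENNReal.zero_rpow_of_pos (by norm_num)] at h1
    have h2 := ENNReal.Tendsto.const_mul h1 (Or.inr (ENNReal.mul_ne_top (by norm_num) ENNReal.ofReal_ne_top) :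
      (0 : ℝ≥0∞) ≠ 0 ∨ 4 * ENNReal.ofReal Cv ≠ ⊤)
    rw [mul_zero] at h2
    exact h2
  -- **the core estimate**, for a.e. `t`: `ofReal (2κ ∫_{(0,t]} gₙ) ≤ a + bₙ Yₙ^{1/2}`
  have hcore : ∀ n, ∀ᵐ t ∂μT, ENNReal.ofReal (2 * κ * ∫ s in Ioc 0 t, g n s) ≤
      a + b n * (ENNReal.ofReal (∫ s, g n s ∂μT)) ^ (1 / 2 : ℝ) := by
    intro n
    filter_upwards [h.ae_integral_sq_molInt_eq hθ₀i (hkS n), ae_restrict_mem measurableSet_Ioo]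
      with t hid htT
    have hsub : Ioc 0 t ⊆ Ioo 0 T := Ioc_subset_Ioo_right htT.2
    have hΦi : IntegrableOn (Φ n) (Ioc 0 t) volume :=
      (h.integrableOn_integral_conv_mul_flux (hkS n)).mono_set hsub
    have hgi' : IntegrableOn (g n) (Ioc 0 t) volume :=
      (show IntegrableOn (g n) (Ioo 0 T) volume from hgi n).mono_set hsub
    -- real form
    have hreal : 2 * κ * ∫ s in Ioc 0 t, g n s ≤
        (∫ x, (θ₀ ⋆ FunctionSpaces.Torus.kernel (ε n)) x ^ 2) + 2 * ∫ s in Ioc 0 t, (Φ n s + κ * g n s) := by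
      have hpos : 0 ≤ ∫ x, ((θ t) ⋆ FunctionSpaces.Torus.kernel (ε n)) x ^ 2 := integral_nonneg fun x => sq_nonneg _
      have hid' : ∫ x, ((θ t) ⋆ FunctionSpaces.Torus.kernel (ε n)) x ^ 2 =
          (∫ x, (θ₀ ⋆ FunctionSpaces.Torus.kernel (ε n)) x ^ 2) + 2 * ∫ s in Ioc 0 t, Φ n s := hid
      rw [hid'] at hpos
      have e : ∫ s in Ioc 0 t, (Φ n s + κ * g n s) = (∫ s in Ioc 0 t, Φ n s) + κ * ∫ s in Ioc 0 t, g n s := by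
        rw [integral_add hΦi (hgi'.const_mul κ), MeasureTheory.integral_const_mul]
      rw [e]
      linarith
    -- pass to `ℝ≥0∞`
    have h1 : ENNReal.ofReal (2 * κ * ∫ s in Ioc 0 t, g n s) ≤
        a + 2 * ∫⁻ s in Ioc 0 t, ENNReal.ofReal (Φ n s + κ * g n s) := by
      refine (ENNReal.ofReal_le_ofReal hreal).trans (ENNReal.ofReal_add_le.trans ?_)
      refine add_le_add (ha0 n) ?_
      rw [ENNReal.ofReal_mul zero_le_two, ENNReal.ofReal_ofNat]
      gcongr
      exact ofReal_integral_le_lintegral_ofReal _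
    -- the slice inequality under the integral
    have h2 : ∫⁻ s in Ioc 0 t, ENNReal.ofReal (Φ n s + κ * g n s) ≤
        ∫⁻ s in Ioc 0 t, ENNReal.ofReal Cv * (2 * E n s) * N n s := by
      refine lintegral_mono_ae (ae_restrict_of_ae_restrict_of_subset hsub ?_)
      filter_upwards [hgood] with s hs
      have hslice := ofReal_integral_conv_mul_flux_add_le (δ := θ s) (ε := ε n) hs.1 hs.2.1 hs.2.2.1
        hs.2.2.2.1 (hε n) (hε' n) κ
      have hgrad : ∀ x, FunctionSpaces.Torus.gradient (θ s ⋆ FunctionSpaces.Torus.kernel (ε n)) x = (θ s ⋆ FunctionSpaces.Torus.gradient (FunctionSpaces.Torus.kernel (ε n))) x :=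
        fun x => FunctionSpaces.Torus.gradient_convolution hs.1 (hkS n) x
      simp only [hgrad] at hslice
      exact hslice
    -- Hölder in time
    have h3 : ∫⁻ s in Ioc 0 t, ENNReal.ofReal Cv * (2 * E n s) * N n s ≤
        2 * ENNReal.ofReal Cv * ((∫⁻ s, E n s ^ 2 ∂μT) ^ (1 / 2 : ℝ) *
          (∫⁻ s, N n s ^ 2 ∂μT) ^ (1 / 2 : ℝ)) := by
      have hH : ∫⁻ s, E n s * N n s ∂μT ≤ (∫⁻ s, E n s ^ 2 ∂μT) ^ (1 / 2 : ℝ) *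
          (∫⁻ s, N n s ^ 2 ∂μT) ^ (1 / 2 : ℝ) := by
        have hH' := ENNReal.lintegral_mul_le_Lp_mul_Lq μT Real.HolderConjugate.two_two (hEm n) (hNm n)
        have e1 : ∫⁻ s, E n s ^ 2 ∂μT = ∫⁻ s, E n s ^ (2 : ℝ) ∂μT :=
          lintegral_congr fun s => by rw [ENNReal.rpow_two]
        have e2 : ∫⁻ s, N n s ^ 2 ∂μT = ∫⁻ s, N n s ^ (2 : ℝ) ∂μT :=
          lintegral_congr fun s => by rw [ENNReal.rpow_two]
        rw [e1, e2]
        exact hH'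
      calc ∫⁻ s in Ioc 0 t, ENNReal.ofReal Cv * (2 * E n s) * N n s
          ≤ ∫⁻ s in Ioo 0 T, ENNReal.ofReal Cv * (2 * E n s) * N n s := lintegral_mono_set hsub
        _ = 2 * ENNReal.ofReal Cv * ∫⁻ s, E n s * N n s ∂μT := by
            rw [hμT, ← lintegral_const_mul' _ _ (ENNReal.mul_ne_top ENNReal.ofNat_ne_top ENNReal.ofReal_ne_top)]
            refine lintegral_congr fun s => ?_
            ring
        _ ≤ 2 * ENNReal.ofReal Cv * ((∫⁻ s, E n s ^ 2 ∂μT) ^ (1 / 2 : ℝ) *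
              (∫⁻ s, N n s ^ 2 ∂μT) ^ (1 / 2 : ℝ)) := by
            gcongr
    calc ENNReal.ofReal (2 * κ * ∫ s in Ioc 0 t, g n s)
        ≤ a + 2 * ∫⁻ s in Ioc 0 t, ENNReal.ofReal (Φ n s + κ * g n s) := h1
      _ ≤ a + 2 * (2 * ENNReal.ofReal Cv * ((∫⁻ s, E n s ^ 2 ∂μT) ^ (1 / 2 : ℝ) *
          (∫⁻ s, N n s ^ 2 ∂μT) ^ (1 / 2 : ℝ))) := by
          gcongr
          exact h2.trans h3
      _ = a + b n * (ENNReal.ofReal (∫ s, g n s ∂μT)) ^ (1 / 2 : ℝ) := by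
          rw [hY n, hb_def]
          ring
  -- **at `t = T`**, in real form: `2κ yₙ ≤ a + bₙ √yₙ` with `yₙ = ∫_{(0,T)} gₙ`
  set y : ℕ → ℝ := fun n => ∫ s, g n s ∂μT with hy_def
  have hy0 : ∀ n, 0 ≤ y n := fun n => integral_nonneg (hg0 n)
  have hyT : ∀ n, 2 * κ * y n ≤ a.toReal + (b n).toReal * Real.sqrt (y n) := by
    intro n
    set R : ℝ≥0∞ := a + b n * (ENNReal.ofReal (y n)) ^ (1 / 2 : ℝ) with hR_def
    have hRt : R ≠ ⊤ := ENNReal.add_ne_top.2 ⟨hat, ENNReal.mul_ne_top (hbt n)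
      (ENNReal.rpow_ne_top_of_nonneg (by norm_num) ENNReal.ofReal_ne_top)⟩
    have hR : R.toReal = a.toReal + (b n).toReal * Real.sqrt (y n) := by
      rw [hR_def, ENNReal.toReal_add hat (ENNReal.mul_ne_top (hbt n)
        (ENNReal.rpow_ne_top_of_nonneg (by norm_num) ENNReal.ofReal_ne_top)), ENNReal.toReal_mul,
        ENNReal.ofReal_rpow_of_nonneg (hy0 n) (by norm_num), ENNReal.toReal_ofReal
          (Real.rpow_nonneg (hy0 n) _), Real.sqrt_eq_rpow]
    have hK : ∀ᵐ t ∂μT, ∫ s in Ioc 0 t, g n s ≤ R.toReal / (2 * κ) := by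
      filter_upwards [hcore n] with t ht
      rw [le_div_iff₀ (by positivity), mul_comm]
      exact (ENNReal.ofReal_le_iff_le_toReal hRt).1 ht
    have := setIntegral_Ioo_le_of_ae_setIntegral_Ioc_le hT (hgi n) hK
    rw [le_div_iff₀ (by positivity)] at this
    rw [← hR]
    linarith
  -- hence `2κ yₙ ≤ a + δ` eventually, for every `δ > 0`
  have hbR : Tendsto (fun n => (b n).toReal) atTop (𝓝 0) := by
    have := (ENNReal.tendsto_toReal ENNReal.zero_ne_top).comp hb0
    rw [ENNReal.toReal_zero] at this
    exact this
  have hev : ∀ δ : ℝ, 0 < δ → ∀ᶠ n in atTop, 2 * κ * y n ≤ a.toReal + δ := fun δ hδ =>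
    eventually_le_add_of_le_add_mul_sqrt hκ ENNReal.toReal_nonneg hy0 hbR hyT hδ
  -- **Fatou**: `2 · eScalarDissipation ≤ liminfₙ ofReal (2κ yₙ)`
  have h2κ : (2 : ℝ≥0∞) * ENNReal.ofReal κ = ENNReal.ofReal (2 * κ) := by
    rw [ENNReal.ofReal_mul zero_le_two, ENNReal.ofReal_ofNat]
  have hFatou : 2 * eScalarDissipation κ θ 0 T ≤
      liminf (fun n => ENNReal.ofReal (2 * κ * y n)) atTop := by
    have hAEm : ∀ n, AEMeasurable (fun s => ENNReal.ofReal (2 * κ) *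
        eScalarGradNormSq (θ s ⋆ FunctionSpaces.Torus.kernel (ε n))) μT := by
      intro n
      refine ((hgm n).aemeasurable.ennreal_ofReal.const_mul (ENNReal.ofReal (2 * κ))).congr ?_
      filter_upwards [hgood] with s hs
      have hA : FunctionSpaces.Torus.IsSmooth (θ s ⋆ FunctionSpaces.Torus.kernel (ε n)) := FunctionSpaces.Torus.isSmooth_convolution hs.1 (hkS n)
      have hgrad : ∀ x, FunctionSpaces.Torus.gradient (θ s ⋆ FunctionSpaces.Torus.kernel (ε n)) x = (θ s ⋆ FunctionSpaces.Torus.gradient (FunctionSpaces.Torus.kernel (ε n))) x :=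
        fun x => FunctionSpaces.Torus.gradient_convolution hs.1 (hkS n) x
      rw [eScalarGradNormSq_eq_ofReal_integral hA]
      simp only [hgrad, hg_def]
    have hint : ∀ n, ∫⁻ s, ENNReal.ofReal (2 * κ) * eScalarGradNormSq (θ s ⋆ FunctionSpaces.Torus.kernel (ε n)) ∂μT =
        ENNReal.ofReal (2 * κ * y n) := by
      intro n
      rw [lintegral_const_mul' _ _ ENNReal.ofReal_ne_top,
        ENNReal.ofReal_mul (p := 2 * κ) (q := y n) (by positivity)]
      congr 1
      rw [hy_def, ofReal_integral_eq_lintegral_ofReal (hgi n) (Eventually.of_forall (hg0 n))]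
      refine lintegral_congr_ae ?_
      filter_upwards [hgood] with s hs
      have hA : FunctionSpaces.Torus.IsSmooth (θ s ⋆ FunctionSpaces.Torus.kernel (ε n)) := FunctionSpaces.Torus.isSmooth_convolution hs.1 (hkS n)
      have hgrad : ∀ x, FunctionSpaces.Torus.gradient (θ s ⋆ FunctionSpaces.Torus.kernel (ε n)) x = (θ s ⋆ FunctionSpaces.Torus.gradient (FunctionSpaces.Torus.kernel (ε n))) x :=
        fun x => FunctionSpaces.Torus.gradient_convolution hs.1 (hkS n) x
      rw [eScalarGradNormSq_eq_ofReal_integral hA]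
      simp only [hgrad, hg_def]
    calc 2 * eScalarDissipation κ θ 0 T
        = ∫⁻ s, ENNReal.ofReal (2 * κ) * eScalarGradNormSq (θ s) ∂μT := by
          rw [eScalarDissipation, ← mul_assoc, h2κ, hμT, lintegral_const_mul' _ _ ENNReal.ofReal_ne_top]
      _ ≤ ∫⁻ s, liminf (fun n => ENNReal.ofReal (2 * κ) * eScalarGradNormSq (θ s ⋆ FunctionSpaces.Torus.kernel (ε n))) atTop ∂μT := by
          refine lintegral_mono_ae ?_
          filter_upwards [hgood, hE0] with s hs hs0
          exact mul_eScalarGradNormSq_le_liminf hs.1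
            (fun n => (FunctionSpaces.Torus.isSmooth_convolution hs.1 (hkS n)).integrable) hs0 ENNReal.ofReal_ne_top
      _ ≤ liminf (fun n => ∫⁻ s, ENNReal.ofReal (2 * κ) * eScalarGradNormSq (θ s ⋆ FunctionSpaces.Torus.kernel (ε n)) ∂μT)
            atTop := lintegral_liminf_le' hAEm
      _ = liminf (fun n => ENNReal.ofReal (2 * κ * y n)) atTop := by
          simp_rw [hint]
  -- conclusion
  refine ENNReal.le_of_forall_pos_le_add fun δ hδ _ => ?_
  have hev' : ∀ᶠ n in atTop, ENNReal.ofReal (2 * κ * y n) ≤ a + δ := by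
    filter_upwards [hev δ hδ] with n hn
    calc ENNReal.ofReal (2 * κ * y n) ≤ ENNReal.ofReal (a.toReal + δ) := ENNReal.ofReal_le_ofReal hn
      _ = a + δ := by
          rw [ENNReal.ofReal_add ENNReal.toReal_nonneg δ.coe_nonneg, ENNReal.ofReal_toReal hat,
            ENNReal.ofReal_coe_nnreal]
  exact hFatou.trans (liminf_le_of_frequently_le hev'.frequently)

/-! ## Subtracting a constant from a weak solution -/

/-- For a.e. `t ∈ (0,T)` the velocity slice `u t` is integrable (`u ∈ L¹(0,T; L²(T^d))`). [folklore] -/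
theorem ae_integrable_velocity (h : IsWeakScalarTransportOn T κ u θ₀ θ) :
    ∀ᵐ t ∂((volume : Measure ℝ).restrict (Ioo 0 T)), Integrable (u t) volume := by
  have hm : AEMeasurable (fun t => (∫⁻ x, ‖u t x‖ₑ ^ 2) ^ (1 / 2 : ℝ))
      ((volume : Measure ℝ).restrict (Ioo 0 T)) :=
    ((h.aestronglyMeasurable_uncurry_velocity.enorm.pow_const 2).lintegral_prod_right').pow_const _
  filter_upwards [ae_lt_top' hm h.lintegral_velocity_lt_top.ne, h.ae_aestronglyMeasurable_velocity_slice]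
    with t ht hmt
  have h2 : ∫⁻ x, ‖u t x‖ₑ ^ 2 < ⊤ := by
    by_contra hc
    rw [not_lt, top_le_iff] at hc
    rw [hc, ENNReal.top_rpow_of_pos (by norm_num)] at ht
    exact lt_irrefl _ ht
  have hmem : MemLp (u t) 2 volume := by
    refine ⟨hmt, ?_⟩
    rw [eLpNorm_eq_lintegral_rpow_enorm_toReal two_ne_zero ENNReal.ofNat_ne_top, ENNReal.toReal_ofNat]
    have e : ∫⁻ x, ‖u t x‖ₑ ^ (2 : ℝ) = ∫⁻ x, ‖u t x‖ₑ ^ 2 := lintegral_congr fun x => by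
      rw [ENNReal.rpow_two]
    rw [e]
    exact ENNReal.rpow_lt_top_of_nonneg (by norm_num) h2.ne
  exact hmem.integrable one_le_two

omit [Fintype d] in
/-- For a space–time test function on `[0,T)`, `T > 0`: `∫_{(0,T)} (∫ ∂ₜψ(t)) dt = -∫ ψ(0)`
(fundamental theorem of calculus for `t ↦ ∫ ψ(t)`, which is `C¹` with derivative `∫ ∂ₜψ(t)`
and vanishes at `t = T`). [folklore] -/
theorem _root_.Literature.Analysis.FunctionSpaces.Torus.IsSpaceTimeTest.setIntegral_integral_timeDeriv [Fintype d]
    {ψ : ℝ → UnitAddTorus d → ℝ} (hψ : FunctionSpaces.Torus.IsSpaceTimeTest T ψ) (hT : 0 < T) :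
    ∫ t in Ioo 0 T, ∫ x, FunctionSpaces.Torus.timeDeriv ψ t x = -∫ x, ψ 0 x := by
  obtain ⟨T', hT'T, hT'⟩ := hψ.2
  have hsm := hψ.isSmoothSpaceTimeOn univ
  have hderiv : ∀ t, HasDerivAt (fun s => ∫ x, ψ s x) (∫ x, FunctionSpaces.Torus.timeDeriv ψ t x) t := by
    intro t
    have h1 := hsm.hasDerivWithinAt_integral convex_univ (mem_univ t)
    rw [hasDerivWithinAt_univ] at h1
    have e : ∫ x, FunctionSpaces.Torus.timeDerivWithin univ ψ t x = ∫ x, FunctionSpaces.Torus.timeDeriv ψ t x :=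
      integral_congr_ae (Eventually.of_forall fun x =>
        FunctionSpaces.Torus.timeDerivWithin_eq_timeDeriv_of_contDiff hψ.1 uniqueDiffOn_univ (mem_univ t) x)
    rwa [e] at h1
  have hcont : Continuous fun t => ∫ x, FunctionSpaces.Torus.timeDeriv ψ t x := by
    have := (hψ.timeDeriv.isSmoothSpaceTimeOn univ).continuousOn_integral convex_univ
    exact continuousOn_univ.1 this
  rw [← integral_Ioc_eq_integral_Ioo, ← intervalIntegral.integral_of_le hT.le,
    intervalIntegral.integral_eq_sub_of_hasDerivAt (fun t _ => hderiv t) (hcont.intervalIntegrable _ _),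
    hT' T hT'T.le]
  simp

/-- `∫_{T^d} Δφ = 0` for smooth `φ` (`Δ = ∑ᵢ ∂ᵢ∂ᵢ` and `∫ ∂ᵢ g = 0` on the torus). [folklore] -/
theorem _root_.Literature.Analysis.FluidPDE.Torus.integral_laplacian_eq_zero {φ : UnitAddTorus d → ℝ} (hφ : FunctionSpaces.Torus.IsSmooth φ) :
    ∫ x, FunctionSpaces.Torus.laplacian φ x = 0 := by
  classical
  simp_rw [FunctionSpaces.Torus.laplacian_eq_sum_partialDeriv_partialDeriv hφ]
  rw [integral_finsetSum _ fun i _ => ((hφ.partialDeriv i).partialDeriv i).integrable]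
  exact Finset.sum_eq_zero fun i _ => FunctionSpaces.Torus.integral_partialDeriv_eq_zero_holds (hφ.partialDeriv i) i

/-- **Weak solutions are stable under subtraction of constants**: if `θ` is a weak solution with
datum `θ₀ ∈ L¹`, then `θ - c` is a weak solution with datum `θ₀ - c` (constants solve the
equation: in the weak form, `∫₀ᵀ∫ (∂ₜψ + u·∇ψ + κΔψ) + ∫ ψ(0) = 0` by the fundamental
theorem of calculus in `t`, weak incompressibility and `∫ Δψ = 0`; DEIJ 2022, §1, mean-zero
reduction). [folklore] -/
theorem sub_const (h : IsWeakScalarTransportOn T κ u θ₀ θ) (hθ₀ : Integrable θ₀ volume) (c : ℝ) :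
    IsWeakScalarTransportOn T κ u (fun x => θ₀ x - c) (fun t x => θ t x - c) where
  aestronglyMeasurable := h.aestronglyMeasurable.sub aestronglyMeasurable_const
  aestronglyMeasurable_velocity := h.aestronglyMeasurable_velocity
  ae_lintegral_sq_le := by
    obtain ⟨C₁, hC₁⟩ := h.exists_eLpNorm_le
    refine ⟨(C₁ + ‖c‖₊) ^ 2, ?_⟩
    filter_upwards [hC₁, h.ae_aestronglyMeasurable_slice] with t ht hm
    have e : ∫⁻ x, ‖θ t x - c‖ₑ ^ 2 = eLpNorm (fun x => θ t x - c) 2 volume ^ 2 :=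
      (PassiveScalarProofs.eLpNorm_two_pow_two _).symm
    rw [e, ENNReal.coe_pow]
    refine pow_le_pow_left' ?_ 2
    calc eLpNorm (fun x => θ t x - c) 2 volume
        ≤ eLpNorm (θ t) 2 volume + eLpNorm (fun _ : UnitAddTorus d => c) 2 volume :=
          eLpNorm_sub_le hm aestronglyMeasurable_const one_le_two
      _ ≤ C₁ + ‖c‖₊ := by
          refine add_le_add ht ?_
          refine (eLpNorm_le_of_ae_bound (C := ‖c‖) (Eventually.of_forall fun _ => le_rfl)).trans ?_
          simp
  lintegral_velocity_lt_top := h.lintegral_velocity_lt_top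
  lintegral_mul_lt_top := by
    set μT : Measure ℝ := (volume : Measure ℝ).restrict (Ioo 0 T) with hμT
    have hmu := h.aestronglyMeasurable_uncurry_velocity
    have hmθ := h.aestronglyMeasurable_uncurry
    have hF : AEMeasurable (fun p : ℝ × UnitAddTorus d => ‖u p.1 p.2‖ₑ * ‖θ p.1 p.2 - c‖ₑ) (μT.prod volume) :=
      hmu.enorm.mul (hmθ.sub aestronglyMeasurable_const).enorm
    have hF₁ : AEMeasurable (fun p : ℝ × UnitAddTorus d => ‖u p.1 p.2‖ₑ * ‖θ p.1 p.2‖ₑ) (μT.prod volume) :=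
      hmu.enorm.mul hmθ.enorm
    have hF₂ : AEMeasurable (fun p : ℝ × UnitAddTorus d => ‖u p.1 p.2‖ₑ) (μT.prod volume) := hmu.enorm
    rw [← lintegral_prod _ hF]
    have hle : ∫⁻ p, ‖u p.1 p.2‖ₑ * ‖θ p.1 p.2 - c‖ₑ ∂(μT.prod volume) ≤
        (∫⁻ p, ‖u p.1 p.2‖ₑ * ‖θ p.1 p.2‖ₑ ∂(μT.prod volume)) +
          ‖c‖ₑ * ∫⁻ p, ‖u p.1 p.2‖ₑ ∂(μT.prod volume) := by
      rw [← lintegral_const_mul'' _ hF₂, ← lintegral_add_left' hF₁]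
      refine lintegral_mono fun p => ?_
      calc ‖u p.1 p.2‖ₑ * ‖θ p.1 p.2 - c‖ₑ ≤ ‖u p.1 p.2‖ₑ * (‖θ p.1 p.2‖ₑ + ‖c‖ₑ) := by
            gcongr
            exact enorm_sub_le
        _ = ‖u p.1 p.2‖ₑ * ‖θ p.1 p.2‖ₑ + ‖c‖ₑ * ‖u p.1 p.2‖ₑ := by ring
    refine lt_of_le_of_lt hle (ENNReal.add_lt_top.2 ⟨?_, ENNReal.mul_lt_top ENNReal.coe_lt_top ?_⟩)
    · rw [lintegral_prod _ hF₁]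
      exact h.lintegral_mul_lt_top
    · rw [lintegral_prod _ hF₂]
      refine lt_of_le_of_lt (lintegral_mono_ae ?_) h.lintegral_velocity_lt_top
      filter_upwards [h.ae_aestronglyMeasurable_velocity_slice] with t hm
      have e : (∫⁻ x, ‖u t x‖ₑ ^ 2) ^ (1 / 2 : ℝ) = eLpNorm (u t) 2 volume := by
        rw [eLpNorm_eq_lintegral_rpow_enorm_toReal two_ne_zero ENNReal.ofNat_ne_top, ENNReal.toReal_ofNat]
        congr 1
        exact lintegral_congr fun x => by rw [ENNReal.rpow_two]
      rw [e, ← eLpNorm_one_eq_lintegral_enorm]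
      exact eLpNorm_le_eLpNorm_of_exponent_le (by norm_num) hm
  ae_isWeaklyDivFree := h.ae_isWeaklyDivFree
  weak_eq := by
    intro ψ hψ
    obtain ⟨T', hT'T, hT'⟩ := hψ.2
    -- the datum term
    have hψ0c : Continuous (ψ 0) := (hψ.isSmooth_slice 0).continuous
    obtain ⟨C0, hC0⟩ := FunctionSpaces.Torus.exists_forall_norm_le_of_continuous hψ0c
    have hdat : ∫ x, (θ₀ x - c) * ψ 0 x = (∫ x, θ₀ x * ψ 0 x) - c * ∫ x, ψ 0 x := by
      simp_rw [sub_mul]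
      rw [integral_sub (hθ₀.mul_bdd hψ0c.aestronglyMeasurable (Eventually.of_forall hC0))
        ((hψ0c.integrable_unitAddTorus).const_mul c), MeasureTheory.integral_const_mul]
    rcases le_or_gt T 0 with hT | hT
    · -- `T ≤ 0`: no time interval, and `ψ 0 = 0`
      have h0 : ψ 0 = 0 := hT' 0 (by linarith)
      have hw := h.weak_eq ψ hψ
      rw [Ioo_eq_empty_of_le hT, Measure.restrict_empty, integral_zero_measure, zero_add] at hw ⊢
      rw [hdat, hw, h0]
      simp
    set μT : Measure ℝ := (volume : Measure ℝ).restrict (Ioo 0 T) with hμT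
    haveI : IsFiniteMeasure μT := by rw [hμT]; infer_instance
    -- integrability of the slices of the weak integrand and of `L = ∂ₜψ + u·∇ψ + κΔψ`
    have hθL : ∀ᵐ t ∂μT, Integrable (fun x => θ t x *
        (FunctionSpaces.Torus.timeDeriv ψ t x + ⟪u t x, FunctionSpaces.Torus.gradient (ψ t) x⟫_ℝ + κ * FunctionSpaces.Torus.laplacian (ψ t) x)) volume :=
      (h.integrable_weakIntegrand hψ).prod_right_ae
    have hLi : ∀ᵐ t ∂μT, Integrable (fun x =>
        FunctionSpaces.Torus.timeDeriv ψ t x + ⟪u t x, FunctionSpaces.Torus.gradient (ψ t) x⟫_ℝ + κ * FunctionSpaces.Torus.laplacian (ψ t) x) volume := by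
      filter_upwards [h.ae_integrable_velocity] with t hu
      have hs : FunctionSpaces.Torus.IsSmooth (ψ t) := hψ.isSmooth_slice t
      obtain ⟨Cg, hCg⟩ := FunctionSpaces.Torus.exists_forall_norm_le_of_continuous hs.gradient.continuous
      refine ((hψ.timeDeriv.isSmooth_slice t).continuous.integrable_unitAddTorus.add ?_).add
        ((continuous_const.mul hs.laplacian.continuous).integrable_unitAddTorus)
      refine Integrable.mono' (hu.norm.mul_const Cg)
        (hu.aestronglyMeasurable.inner hs.gradient.continuous.aestronglyMeasurable)
        (Eventually.of_forall fun x => ?_)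
      rw [Real.norm_eq_abs]
      exact (abs_real_inner_le_norm _ _).trans (mul_le_mul_of_nonneg_left (hCg _) (norm_nonneg _))
    have hLint : ∀ᵐ t ∂μT, ∫ x, (FunctionSpaces.Torus.timeDeriv ψ t x + ⟪u t x, FunctionSpaces.Torus.gradient (ψ t) x⟫_ℝ +
        κ * FunctionSpaces.Torus.laplacian (ψ t) x) = ∫ x, FunctionSpaces.Torus.timeDeriv ψ t x := by
      filter_upwards [h.ae_integrable_velocity, h.ae_isWeaklyDivFree] with t hu hdiv
      have hs : FunctionSpaces.Torus.IsSmooth (ψ t) := hψ.isSmooth_slice t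
      obtain ⟨Cg, hCg⟩ := FunctionSpaces.Torus.exists_forall_norm_le_of_continuous hs.gradient.continuous
      have i1 : Integrable (fun x => FunctionSpaces.Torus.timeDeriv ψ t x) volume :=
        (hψ.timeDeriv.isSmooth_slice t).continuous.integrable_unitAddTorus
      have i2 : Integrable (fun x => ⟪u t x, FunctionSpaces.Torus.gradient (ψ t) x⟫_ℝ) volume := by
        refine Integrable.mono' (hu.norm.mul_const Cg)
          (hu.aestronglyMeasurable.inner hs.gradient.continuous.aestronglyMeasurable)
          (Eventually.of_forall fun x => ?_)
        rw [Real.norm_eq_abs]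
        exact (abs_real_inner_le_norm _ _).trans (mul_le_mul_of_nonneg_left (hCg _) (norm_nonneg _))
      have i3 : Integrable (fun x => κ * FunctionSpaces.Torus.laplacian (ψ t) x) volume :=
        (continuous_const.mul hs.laplacian.continuous).integrable_unitAddTorus
      have i12 : Integrable (fun x => FunctionSpaces.Torus.timeDeriv ψ t x + ⟪u t x, FunctionSpaces.Torus.gradient (ψ t) x⟫_ℝ) volume :=
        i1.add i2
      rw [integral_add i12 i3, integral_add i1 i2, hdiv _ hs, MeasureTheory.integral_const_mul,
        integral_laplacian_eq_zero hs]
      ring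
    -- the time integral of the shifted weak integrand
    have hpt : ∀ᵐ t ∂μT, ∫ x, (θ t x - c) *
        (FunctionSpaces.Torus.timeDeriv ψ t x + ⟪u t x, FunctionSpaces.Torus.gradient (ψ t) x⟫_ℝ + κ * FunctionSpaces.Torus.laplacian (ψ t) x) =
        (∫ x, θ t x * (FunctionSpaces.Torus.timeDeriv ψ t x + ⟪u t x, FunctionSpaces.Torus.gradient (ψ t) x⟫_ℝ + κ * FunctionSpaces.Torus.laplacian (ψ t) x)) -
          c * ∫ x, FunctionSpaces.Torus.timeDeriv ψ t x := by
      filter_upwards [hθL, hLi, hLint] with t h1 h2 h3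
      simp_rw [sub_mul]
      rw [integral_sub h1 (h2.const_mul c), MeasureTheory.integral_const_mul, h3]
    have hI1 : Integrable (fun t => ∫ x, θ t x *
        (FunctionSpaces.Torus.timeDeriv ψ t x + ⟪u t x, FunctionSpaces.Torus.gradient (ψ t) x⟫_ℝ + κ * FunctionSpaces.Torus.laplacian (ψ t) x)) μT :=
      (h.integrable_weakIntegrand hψ).integral_prod_left
    have hcont : Continuous fun t => ∫ x, FunctionSpaces.Torus.timeDeriv ψ t x := by
      have := (hψ.timeDeriv.isSmoothSpaceTimeOn univ).continuousOn_integral convex_univ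
      exact continuousOn_univ.1 this
    have hI2 : Integrable (fun t => c * ∫ x, FunctionSpaces.Torus.timeDeriv ψ t x) μT :=
      ((continuous_const.mul hcont).integrableOn_Icc (a := 0) (b := T)).mono_set Ioo_subset_Icc_self
    have hw := h.weak_eq ψ hψ
    have htime := hψ.setIntegral_integral_timeDeriv hT
    show (∫ t in Ioo 0 T, ∫ x, (θ t x - c) *
        (FunctionSpaces.Torus.timeDeriv ψ t x + ⟪u t x, FunctionSpaces.Torus.gradient (ψ t) x⟫_ℝ + κ * FunctionSpaces.Torus.laplacian (ψ t) x)) +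
      ∫ x, (θ₀ x - c) * ψ 0 x = 0
    rw [integral_congr_ae hpt, integral_sub hI1 hI2, MeasureTheory.integral_const_mul, hdat]
    rw [hμT] at *
    rw [htime]
    linear_combination hw

/-! ## Discharge of `eScalarDissipation_le_variance` -/

/-- Subtracting a constant does not change the spectral squared gradient norm of an integrable
scalar (only the zero mode moves, and it carries the weight `|0|² = 0`). [folklore] -/
theorem _root_.Literature.Analysis.FluidPDE.Torus.eScalarGradNormSq_sub_const {θ : UnitAddTorus d → ℝ} (hθ : Integrable θ volume)
    (c : ℝ) : eScalarGradNormSq (fun x => θ x - c) = eScalarGradNormSq θ := by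
  rw [eScalarGradNormSq_eq_tsum, eScalarGradNormSq_eq_tsum]
  congr 1
  refine tsum_congr fun k => ?_
  by_cases hk : k = 0
  · subst hk
    simp [FunctionSpaces.Torus.freqNormSq]
  · congr 2
    have hsub : (fun x => ((θ x - c : ℝ) : ℂ)) = (fun x => (θ x : ℂ)) - fun _ => (c : ℂ) := by
      funext x
      simp
    rw [hsub, FunctionSpaces.Torus.mFourierCoeff_sub hθ.ofReal (integrable_const _)]
    have h0 : mFourierCoeff (fun _ : UnitAddTorus d => (c : ℂ)) k = 0 := by
      rw [FunctionSpaces.Torus.mFourierCoeff_eq_integral_volume]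
      simp_rw [smul_eq_mul, integral_mul_const, FunctionSpaces.Torus.integral_mFourier, neg_eq_zero, if_neg hk, zero_mul]
    rw [h0, sub_zero]

/-- `∫⁻ ‖θ₀ - ⨍θ₀‖ₑ² = ofReal (Var θ₀)` for `θ₀ ∈ L²(T^d)`. [folklore] -/
theorem _root_.Literature.Analysis.FluidPDE.Torus.lintegral_enorm_sub_scalarMean_sq {θ₀ : UnitAddTorus d → ℝ}
    (hθ₀ : MemLp θ₀ 2 volume) :
    ∫⁻ x, ‖θ₀ x - scalarMean θ₀‖ₑ ^ 2 = ENNReal.ofReal (scalarVariance θ₀) := by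
  have hm : MemLp (fun x => θ₀ x - scalarMean θ₀) 2 volume := hθ₀.sub (memLp_const _)
  rw [scalarVariance_eq_integral hθ₀.1.aemeasurable,
    ofReal_integral_eq_lintegral_ofReal hm.integrable_sq (Eventually.of_forall fun x => sq_nonneg _)]
  refine lintegral_congr fun x => ?_
  rw [← sq_abs, ENNReal.ofReal_pow (abs_nonneg _), ← Real.enorm_eq_ofReal_abs]

/-- **Discharge of `Torus.IsWeakScalarTransportOn.eScalarDissipation_le_variance`** — the
energy inequality in variance form: for `κ > 0`, `θ₀ ∈ L²`, `u ∈ L^∞((0,T) × T^d)` and every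
weak solution on `[0,T)`, `2κ ∫₀ᵀ ‖∇θ(t)‖²_{L²} dt ≤ Var θ₀ = ‖θ₀ - ⨍θ₀‖²_{L²}`
(Drivas–Elgindi–Iyer–Jeong 2022, (1.2) for mean-zero data; rigorous weak-solution form:
Bonicatto–Ciampa–Crippa 2023, Thm. 3.3): `θ - ⨍θ₀` is a weak solution with datum
`θ₀ - ⨍θ₀` (`sub_const`) and the same gradient norm, so `energy_ineq_holds` applies to it. [cite: DEIJ2022, (1.2)] -/
theorem eScalarDissipation_le_variance_holds :
    IsWeakScalarTransportOn.eScalarDissipation_le_variance (d := d) := by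
  intro T κ hκ u θ₀ θ h hθ₀ hu
  have hθ₀i : Integrable θ₀ volume := hθ₀.integrable one_le_two
  have h' := h.sub_const hθ₀i (scalarMean θ₀)
  have hθ₀' : MemLp (fun x => θ₀ x - scalarMean θ₀) 2 volume := hθ₀.sub (memLp_const _)
  have key := energy_ineq_holds hκ h' hθ₀' hu
  have e1 : eScalarDissipation κ (fun t x => θ t x - scalarMean θ₀) 0 T = eScalarDissipation κ θ 0 T := by
    simp only [eScalarDissipation]
    congr 1
    refine lintegral_congr_ae ?_
    filter_upwards [h.ae_slice_integrable₁] with t ht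
    exact eScalarGradNormSq_sub_const ht.1 _
  rwa [e1, lintegral_enorm_sub_scalarMean_sq hθ₀] at key

end IsWeakScalarTransportOn

end Torus

end Literature.Analysis.FluidPDE
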